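import Mathlib
import Summits.NavierStokesRegularity.NavierStokesRegularity.Theses.ExactWindowRungThree
import HarnessLib

/-!
# `ExactWindowRungThree.Assembly` — the route's assembly (item stmt-NavierStokesRegularity-22417;
  pure logic)

**Statement.** `ExactFlowCertificate → TailEnvelopes → TransferBootstrap → RestartControl →
RestartGlue → LocalDynamicsSufficesAt → TaoLadderRungThree.Target`.

PROOF. The route file `Theses/ExactWindowRungThree.lean` carries the planner-authored,
kernel-checked deciding theorem `Theses.ExactWindowRungThree.closes`, whose hypotheses are exactly
the route's two cruxes and four supports and whose conclusion is the rung leaf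
`TaoLadderRungThree.Target` (TL-M3, D-0061); the assembly item is that implication written as ONE
proposition, so it is closed by applying `closes` to the hypotheses.

HONEST FRAMING: glue between the route's own statements about a MODEL lattice (Tao 2016's dyadic
comparable-table cascade); nothing here is a statement about the Navier–Stokes equations, and the
rung leaf is not the summit Statement.
-/

noncomputable section

set_option linter.dupNamespace false

namespace Summit.NavierStokesRegularity.NavierStokesRegularity.Theorems

open Summit.NavierStokesRegularity.NavierStokesRegularity.Theses.ExactWindowRungThree in
/-- **Item stmt-NavierStokesRegularity-22417** (`ExactWindowRungThree.Assembly`): the route's two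
cruxes and four supports imply its rung leaf `TaoLadderRungThree.Target`, by the route file's
deciding theorem `closes`. [this file] -/
theorem exactWindowRungThree_assembly_proof :
    Summit.NavierStokesRegularity.NavierStokesRegularity.Theses.ExactWindowRungThree.Assembly := by
  unfold Summit.NavierStokesRegularity.NavierStokesRegularity.Theses.ExactWindowRungThree.Assembly
  intro h₁ h₂ h₃ h₄ h₅ h₆
  -- buildfix (bf3-g27, 2026-08-27): the route's `closes` was re-keyed (23:42Z) to `ExactFlowCertificateR` /
  -- `TransferBootstrapR`; this CLOSED assembly item keeps its accepted v1 statement. The v1 bootstrap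
  -- `h₃ h₁ h₂` yields the same witness tuple as the R version, so the chain of `closes` is inlined verbatim.
  obtain ⟨ε₀, R, θ, c, η, i₀, α, X₀, P, env, hε₁, hR, hθ0, hθ, hc, hη, hα, hX₀, hP, hstep⟩ := h₃ h₁ h₂
  have hε₀ : 0 < ε₀ := by rw [hε₁]; exact one_pos
  have hdyn : Literature.Analysis.FluidPDE.TaoCascade.DynamicsLocalAt ε₀ R := by
    refine ⟨θ, c, i₀, α, X₀, P, Literature.Analysis.FluidPDE.TaoCascade.epochEnvelope env,
      hθ0, by linarith, hc, hα, hX₀, hP, ?_⟩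
    intro K₁ K₂ hK₁ hK₂
    obtain ⟨N₀, hN₀⟩ := h₄ ε₀ θ c η i₀ α X₀ P env K₁ K₂ hε₀ hθ hc.le hη hX₀ hK₁ hK₂
    refine ⟨N₀, fun n₀ hn₀ T hT X E hsol N hN t e hcp hhor => ?_⟩
    have heN : 0 < e N := hcp.e_pos N hN le_rfl
    have hpow : 0 < (1 + ε₀) ^ ((5 : ℝ) * N / 2) := Real.rpow_pos_of_pos (by linarith) _
    have hγ : 0 < e N * (1 + ε₀) ^ ((5 : ℝ) * N / 2) := mul_pos heN hpow
    have hneg : (1 + ε₀) ^ (-(5 : ℝ) * N / 2) = ((1 + ε₀) ^ ((5 : ℝ) * N / 2))⁻¹ := by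
      rw [← Real.rpow_neg (by linarith : (0 : ℝ) ≤ 1 + ε₀)]
      congr 1
      ring
    have hcγ : c * (1 + ε₀) ^ (-(5 : ℝ) * N / 2) * (e N)⁻¹ =
        c / (e N * (1 + ε₀) ^ ((5 : ℝ) * N / 2)) := by
      rw [hneg]
      field_simp
    rw [hcγ] at hhor
    have hdiv : 0 < c / (e N * (1 + ε₀) ^ ((5 : ℝ) * N / 2)) := div_pos hc hγ
    have htN : t N < T := by linarith
    have hτ : c ≤ (T - t N) * (e N * (1 + ε₀) ^ ((5 : ℝ) * N / 2)) := by
      have h2 : c / (e N * (1 + ε₀) ^ ((5 : ℝ) * N / 2)) ≤ T - t N := by linarith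
      have h3 := mul_le_mul_of_nonneg_right h2 hγ.le
      rwa [div_mul_cancel₀ c hγ.ne'] at h3
    obtain ⟨hflow, hslack⟩ := hN₀ n₀ hn₀ T hT X E hsol N hN t e hcp htN
    obtain ⟨τ₁, a, hst⟩ :=
      hstep (N - n₀).toNat _ _ _ (hcp.state N hN le_rfl) hslack _ hτ _ _ hflow
    exact ⟨_, _, h₅ ε₀ θ c 4 i₀ n₀ X₀ _ _ N X E t e τ₁ a hε₀ hN hcp hst⟩
  rw [hε₁] at hdyn
  obtain ⟨α', X₀', hα', hng⟩ := h₆ 1 R one_pos hR hdyn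
  exact ⟨R, hR, α', X₀', hα', hng⟩

end Summit.NavierStokesRegularity.NavierStokesRegularity.Theorems

end
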